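import Summits.Ventures.PercRepro.C041TriDomAnchoredZMerge

/-!
# ROW C-041 — THEOREM (THE ANCHORED CONJECTURE): the anchored orientation of CONJECTURE (STOCHASTIC DOMINATION) holds
on every status of every finite host (p6, gen 48; P6-TWOEXIT-LEAN.md §53 ADDENDUM 22 cont. 3)

THE STATEMENT (`ancDominationS_of_S1`, all-free `ancDomination_of_S1`): for every status `st` and every up-set `V`,
`#(V ∩ ((s₁,s₂) ∪ (s₂,s₃) ∪ (s₁,s₃))) ≤ #(V ∩ (⊤,⊥))` (`AncDominationS`, anchor `x = a₁`, exits `y = u`, `z = u'`)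
— the up-set form of the ORIENTED EXCESS INEQUALITY `N_RB + N_WRj + N_RWj ≤ N_RRa` of §53, now on every up-set.

PROOF — FROM THEOREM (S1) BY ONE z-ANCHORED SPLIT, NO INDUCTION (the pattern layer is `C041TriDomAnchoredZMerge`).
(A) If no free edge touches the double-component of `z`, the red and the blue connections of `z` agree in every
colouring and `AncF` vanishes (`cntF_ancF_eq_zero`).  (B) Otherwise let `f = pq` be free with `p` in that component.
Slicing the count at `f` (`cntF_rec`): `2·Σ_V AncF = Σ_{V_R} AncF(σ ∨ zq, τ) + Σ_{V_B} AncF(σ, τ ∨ zq)`, and with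
`W = {x ~_R y ∨ x ~_R z ∨ x ~_R q}`, `W′ = {x ~_R y ∨ x ~_R z}` (up-sets of the deletion, `RdS_mono_st`) the key
inequalities give `2·Σ_V AncF ≥ cntS1 (st[f := absent]) (V_R ∩ W) + cntS1 (st[f := double]) (V_B ∩ W′) ≥ 0` by
THEOREM (S1) for the marks `(x, y; z)` (`cntF_ancF_nonneg_step`).  The certificate was found by the refined-type LP
of this gen and checked exactly; the two `decide`s are its pointwise content.
-/

namespace PercRepro

namespace ZoneZ

namespace MultiExit

open ZoneData Finset

variable {V₁ E₁ U₁ U₂ : Type} (Z₁ : ZoneData V₁ E₁ U₁ U₂) (u u' a₁ : V₁)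

variable [DecidableEq E₁]

/-! ## The count and the theorem -/

variable [Fintype E₁]

open Classical in
/-- The count of the anchored functional is `#(V ∩ (⊤,⊥)) − #(V ∩ anchored crossed)`. -/
theorem cntF_ancF_eq (st : E₁ → EStat) (V : (E₁ → Bool) → Prop) :
    cntF Z₁ u u' a₁ AncF st V =
      ((univ.filter fun ω : E₁ → Bool => V ω ∧ TopBotS Z₁ a₁ u u' st ω).card : ℤ)
        - (univ.filter fun ω : E₁ → Bool => V ω ∧ AncCrossedS Z₁ a₁ u u' st ω).card := by
  rw [← sum_ite_sub_eq_card_sub]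
  unfold cntF
  refine Finset.sum_congr rfl fun ω _ => ?_
  by_cases hv : V ω
  · by_cases ht : TopBotS Z₁ a₁ u u' st ω <;> by_cases hc : AncCrossedS Z₁ a₁ u u' st ω <;>
      simp only [TopBotS, AncCrossedS] at ht hc <;> simp [AncF, TopBotS, AncCrossedS, hv, ht, hc]
  · simp [hv]

open Classical in
/-- Without a free edge at the double-component of `z` the count of the anchored functional vanishes. -/
theorem cntF_ancF_eq_zero (st : E₁ → EStat)
    (hA : ∀ e, st e = .free → ¬ (Z₁.fst e ∈ dblCompS Z₁ st u' ∨ Z₁.snd e ∈ dblCompS Z₁ st u'))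
    (V : (E₁ → Bool) → Prop) : cntF Z₁ u u' a₁ AncF st V = 0 := by
  unfold cntF
  refine Finset.sum_eq_zero fun ω _ => ?_
  have h : AncF (rsig Z₁ u u' a₁ st ω) (bsig Z₁ u u' a₁ st ω) = 0 := by
    apply AncF_eq_zero_of_exit_eq
    · simp only [rsig, bsig, decide_eq_decide]
      rw [RdS_comm Z₁ st ω a₁ u', MgS_comm Z₁ st ω a₁ u', RdS_iff_dblComp Z₁ u' st hA, MgS_iff_dblComp Z₁ u' st hA]
    · simp only [rsig, bsig, decide_eq_decide]
      rw [RdS_comm Z₁ st ω u u', MgS_comm Z₁ st ω u u', RdS_iff_dblComp Z₁ u' st hA, MgS_iff_dblComp Z₁ u' st hA]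
  rw [h]
  simp

open Classical in
/-- **The z-anchored split**: at a free edge `f = pq` with `p` in the double-component of `z`, the count of the
anchored functional is non-negative, by THEOREM (S1) for the marks `(x, y; z)` on `V_R ∩ W` and `V_B ∩ W′`. -/
theorem cntF_ancF_nonneg_step {st : E₁ → EStat} {f : E₁} (hf : st f = .free) {p q : V₁} (hj : Z₁.Joins f p q)
    (hp : p ∈ dblCompS Z₁ st u') {V : (E₁ → Bool) → Prop} (hV : UpSet V) :
    0 ≤ cntF Z₁ u u' a₁ AncF st V := by
  have hrec := cntF_rec Z₁ u u' a₁ AncF st f hf V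
  -- the two up-sets of the certificate
  have hW : UpSet fun ω : E₁ → Bool => sliceV V f true ω ∧
      Wa (rsig6 Z₁ u u' q a₁ (Function.update st f .absent) ω) = true := by
    intro ω ω' h hle
    refine ⟨upSet_sliceV hV f true ω ω' h.1 hle, ?_⟩
    have h2 := h.2
    rw [wa_iff] at h2 ⊢
    rcases h2 with h2 | h2 | h2
    · exact Or.inl (RdS_mono_st Z₁ _ hle h2)
    · exact Or.inr (Or.inl (RdS_mono_st Z₁ _ hle h2))
    · exact Or.inr (Or.inr (RdS_mono_st Z₁ _ hle h2))
  have hW' : UpSet fun ω : E₁ → Bool => sliceV V f false ω ∧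
      Wd (rsig6 Z₁ u u' q a₁ (Function.update st f .absent) ω) = true := by
    intro ω ω' h hle
    refine ⟨upSet_sliceV hV f false ω ω' h.1 hle, ?_⟩
    have h2 := h.2
    rw [wd_iff] at h2 ⊢
    rcases h2 with h2 | h2
    · exact Or.inl (RdS_mono_st Z₁ _ hle h2)
    · exact Or.inr (RdS_mono_st Z₁ _ hle h2)
  have hS1a := cntS1_nonneg Z₁ a₁ u u' (Function.update st f .absent) hW
  have hS1d := cntS1_nonneg Z₁ a₁ u u' (Function.update st f .double) hW'
  -- the pointwise inequality
  have hpt : ∀ ω : E₁ → Bool,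
      (if sliceV V f true ω ∧ Wa (rsig6 Z₁ u u' q a₁ (Function.update st f .absent) ω) = true then
          S1F (rsig Z₁ a₁ u u' (Function.update st f .absent) ω) (bsig Z₁ a₁ u u' (Function.update st f .absent) ω)
        else 0)
        + (if sliceV V f false ω ∧ Wd (rsig6 Z₁ u u' q a₁ (Function.update st f .absent) ω) = true then
            S1F (rsig Z₁ a₁ u u' (Function.update st f .double) ω)
              (bsig Z₁ a₁ u u' (Function.update st f .double) ω)
          else 0) ≤
      (if sliceV V f true ω then
          AncF (rsig Z₁ u u' a₁ (Function.update st f .double) ω) (bsig Z₁ u u' a₁ (Function.update st f .absent) ω)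
        else 0)
        + (if sliceV V f false ω then
            AncF (rsig Z₁ u u' a₁ (Function.update st f .absent) ω)
              (bsig Z₁ u u' a₁ (Function.update st f .double) ω)
          else 0) := by
    intro ω
    rw [rsig_permZ Z₁ u u' a₁ (Function.update st f .absent), bsig_permZ Z₁ u u' a₁ (Function.update st f .absent),
      rsig_permZ Z₁ u u' a₁ (Function.update st f .double), bsig_permZ Z₁ u u' a₁ (Function.update st f .double),
      rsig_double_zmerge Z₁ u u' a₁ hf ω hj hp, bsig_double_zmerge Z₁ u u' a₁ hf ω hj hp,
      rsig_eq_proj3 Z₁ u u' a₁ (Function.update st f .absent) ω q,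
      bsig_eq_proj3 Z₁ u u' a₁ (Function.update st f .absent) ω q]
    have h := anc_ind_ineq (sliceV V f true ω) (sliceV V f false ω) (sliceV_false_le hV f ω)
      (rsig6 Z₁ u u' q a₁ (Function.update st f .absent) ω) (bsig6 Z₁ u u' q a₁ (Function.update st f .absent) ω)
      (trans6_rsig6 Z₁ u u' q a₁ _ ω) (trans6_bsig6 Z₁ u u' q a₁ _ ω)
    simpa only [S1zF] using h
  have hsum : cntS1 Z₁ a₁ u u' (Function.update st f .absent) (fun ω => sliceV V f true ω ∧
        Wa (rsig6 Z₁ u u' q a₁ (Function.update st f .absent) ω) = true)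
      + cntS1 Z₁ a₁ u u' (Function.update st f .double) (fun ω => sliceV V f false ω ∧
        Wd (rsig6 Z₁ u u' q a₁ (Function.update st f .absent) ω) = true) ≤
      (∑ ω : E₁ → Bool, if sliceV V f true ω then
          AncF (rsig Z₁ u u' a₁ (Function.update st f .double) ω) (bsig Z₁ u u' a₁ (Function.update st f .absent) ω)
        else 0)
        + ∑ ω : E₁ → Bool, if sliceV V f false ω then
            AncF (rsig Z₁ u u' a₁ (Function.update st f .absent) ω)
              (bsig Z₁ u u' a₁ (Function.update st f .double) ω)
          else 0 := by
    unfold cntS1 cntF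
    rw [← Finset.sum_add_distrib, ← Finset.sum_add_distrib]
    exact Finset.sum_le_sum fun ω _ => by
      convert hpt ω
      rfl
  linarith

open Classical in
/-- **THEOREM (THE ANCHORED CONJECTURE), status form**: on every up-set of every status the anchored crossed
classes `(s₁,s₂) ∪ (s₂,s₃) ∪ (s₁,s₃)` are outnumbered by `(⊤,⊥)`. -/
theorem ancDominationS_of_S1 (st : E₁ → EStat) : AncDominationS Z₁ a₁ u u' st := by
  intro V hV
  have h0 : 0 ≤ cntF Z₁ u u' a₁ AncF st V := by
    by_cases hex : ∃ f, st f = .free ∧ (Z₁.fst f ∈ dblCompS Z₁ st u' ∨ Z₁.snd f ∈ dblCompS Z₁ st u')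
    · obtain ⟨f, hf, hT⟩ := hex
      rcases hT with hp | hp
      · exact cntF_ancF_nonneg_step Z₁ u u' a₁ hf (Or.inl ⟨rfl, rfl⟩) hp hV
      · exact cntF_ancF_nonneg_step Z₁ u u' a₁ hf (Or.inr ⟨rfl, rfl⟩) hp hV
    · have hA : ∀ e, st e = .free → ¬ (Z₁.fst e ∈ dblCompS Z₁ st u' ∨ Z₁.snd e ∈ dblCompS Z₁ st u') :=
        fun e he h => hex ⟨e, he, h⟩
      rw [cntF_ancF_eq_zero Z₁ u u' a₁ st hA V]
  rw [cntF_ancF_eq] at h0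
  exact_mod_cast sub_nonneg.mp h0

open Classical in
/-- **THEOREM (THE ANCHORED CONJECTURE)**: every finite host with three marks satisfies the anchored orientation of
CONJECTURE (STOCHASTIC DOMINATION) — the up-set form of the oriented excess inequality. -/
theorem ancDomination_of_S1 : AncDomination Z₁ u u' a₁ :=
  (ancDominationS_free Z₁ a₁ u u').mp (ancDominationS_of_S1 Z₁ u u' a₁ _)

end MultiExit

end ZoneZ

end PercRepro
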